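import Summits.AnomalousDissipation.AnomalousDissipation.Theorems.SawtoothPulseCascadeK1LocalisedCascadeKHStableRotation
import Summits.AnomalousDissipation.AnomalousDissipation.Theorems.SawtoothPulseCascadeK1LocalisedCascadeKHLineKernel

/-!
# K2 lane (route-2 `SawtoothPulseCascade`, crux dir `K1LocalisedCascade`): sizes of the block entries and of the kernel coefficients (numeric bricks)

Helper file of the K2 lane (ACL item stmt-AnomalousDissipation-19491; S2-cert forced part / P1″). The numeric evaluation of the twelve-term creation bound
(`…KHSourceResponse`, crux `K2StableCreation.lean`) needs the sizes of (i) the entries of p4's block `X = 2πia·[[−¼−2G₀, −2G_h],[2conj G_h, ¼+2G₀]]`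
(`2πG₀ = Σ₀`, `2π conj G_h = S`) and (ii) the two kernel coefficients `A = −1/((1−z̄q)2κ)`, `B = −zq/((1−zq)2κ)` (`κ = 2πa`, `z = e^{2πiβ}`, `q = e^{−κ}`):
* `norm_one_sub_mul_ge`: `‖1 − wq‖ ≥ 1 − q` for `‖w‖ = 1`, `0 ≤ q`;
* `norm_coefA_le`, `norm_coefB_le`: `‖A‖ ≤ 1/((1−q)·2κ)`, `‖B‖ ≤ q/((1−q)·2κ)`;
* `norm_blockX_diag_eq`: `‖2πia(∓¼ ∓ 2G₀)‖ = a·|π/2 + 2Σ₀|`; `norm_blockX_diag_le`: `≤ πa/2 − (1−q)/(1+q)` for `a ≥ 1` (`…KHStableDetuning`);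
* `norm_blockX_off_eq`: `‖2πia·2G_h‖ = 2a‖S‖`; `norm_blockX_off_le`: `≤ 40/399` for `a ≥ 1` (`normSq_sawS_le`, `q ≤ 1/400`).
No definitions; no statement about the crux. [cite: Drazin2002, §8.3 (8.36)–(8.38)] [problem: turb]
-/

-- `Summit.<Summit>.<Problem>`: single-conjunct summit, the duplicate namespace segment is deliberate.
set_option linter.dupNamespace false

noncomputable section

namespace Summit.AnomalousDissipation.AnomalousDissipation.Theorems.SawtoothPulseCascade.K2PhaseBudget

open Set Literature.Analysis.FluidPDE.SawtoothCascade

/-! ## §1 The kernel coefficients -/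

/-- `‖1 − w·q‖ ≥ 1 − q` when `‖w‖ = 1` and `0 ≤ q` (reverse triangle inequality). [folklore] -/
theorem norm_one_sub_mul_ge {w : ℂ} {q : ℝ} (hw : ‖w‖ = 1) (hq : 0 ≤ q) : 1 - q ≤ ‖1 - w * (q : ℂ)‖ := by
  have h := norm_sub_norm_le (1 : ℂ) (w * (q : ℂ))
  rw [norm_one, norm_mul, hw, one_mul, Complex.norm_real, Real.norm_eq_abs, abs_of_nonneg hq] at h
  linarith [abs_le.1 (abs_norm_sub_norm_le (1 : ℂ) (w * (q : ℂ)))]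

/-- **`‖A‖ ≤ 1/((1−q)·2κ)`** for `A = −1/((1 − z̄q)·2κ)`, `κ = 2πa > 0`, `q = e^{−κ} < 1`. [cite: Drazin2002, §8.3 (8.36)–(8.38)] -/
theorem norm_coefA_le {a : ℝ} (ha : 0 < a) (β : ℝ) :
    ‖(-1 / ((1 - starRingEnd ℂ (Complex.exp (2 * Real.pi * β * Complex.I)) * (Real.exp (-(2 * Real.pi * a)) : ℂ)) * (2 * (2 * Real.pi * a))) : ℂ)‖ ≤
      1 / ((1 - Real.exp (-(2 * Real.pi * a))) * (2 * (2 * Real.pi * a))) := by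
  set q : ℝ := Real.exp (-(2 * Real.pi * a)) with hq
  have hq0 : 0 < q := Real.exp_pos _
  have hq1 : q < 1 := by rw [hq]; exact Real.exp_lt_one_iff.2 (by nlinarith [Real.pi_pos])
  have hzn : ‖starRingEnd ℂ (Complex.exp (2 * Real.pi * β * Complex.I))‖ = 1 := by
    rw [Complex.norm_conj, show (2 * Real.pi * β * Complex.I : ℂ) = ((2 * Real.pi * β : ℝ) : ℂ) * Complex.I by push_cast; ring]
    exact Complex.norm_exp_ofReal_mul_I _
  have hd := norm_one_sub_mul_ge hzn hq0.le
  have hκ : (0 : ℝ) < 2 * (2 * Real.pi * a) := by positivity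
  rw [norm_div, norm_neg, norm_one, norm_mul, show ‖(2 * (2 * Real.pi * a) : ℂ)‖ = 2 * (2 * Real.pi * a) by
    rw [show (2 * (2 * Real.pi * a) : ℂ) = ((2 * (2 * Real.pi * a) : ℝ) : ℂ) by push_cast; ring, Complex.norm_real, Real.norm_eq_abs,
      abs_of_pos hκ]]
  exact one_div_le_one_div_of_le (by nlinarith) (mul_le_mul_of_nonneg_right hd hκ.le)

/-- **`‖B‖ ≤ q/((1−q)·2κ)`** for `B = −zq/((1 − zq)·2κ)`. [cite: Drazin2002, §8.3 (8.36)–(8.38)] -/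
theorem norm_coefB_le {a : ℝ} (ha : 0 < a) (β : ℝ) :
    ‖(-(Complex.exp (2 * Real.pi * β * Complex.I) * (Real.exp (-(2 * Real.pi * a)) : ℂ)) /
        ((1 - Complex.exp (2 * Real.pi * β * Complex.I) * (Real.exp (-(2 * Real.pi * a)) : ℂ)) * (2 * (2 * Real.pi * a))) : ℂ)‖ ≤
      Real.exp (-(2 * Real.pi * a)) / ((1 - Real.exp (-(2 * Real.pi * a))) * (2 * (2 * Real.pi * a))) := by
  set q : ℝ := Real.exp (-(2 * Real.pi * a)) with hq
  have hq0 : 0 < q := Real.exp_pos _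
  have hq1 : q < 1 := by rw [hq]; exact Real.exp_lt_one_iff.2 (by nlinarith [Real.pi_pos])
  have hzn : ‖Complex.exp (2 * Real.pi * β * Complex.I)‖ = 1 := by
    rw [show (2 * Real.pi * β * Complex.I : ℂ) = ((2 * Real.pi * β : ℝ) : ℂ) * Complex.I by push_cast; ring]
    exact Complex.norm_exp_ofReal_mul_I _
  have hd := norm_one_sub_mul_ge hzn hq0.le
  have hκ : (0 : ℝ) < 2 * (2 * Real.pi * a) := by positivity
  rw [norm_div, norm_neg, norm_mul, hzn, one_mul, Complex.norm_real, Real.norm_eq_abs, abs_of_pos hq0, norm_mul,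
    show ‖(2 * (2 * Real.pi * a) : ℂ)‖ = 2 * (2 * Real.pi * a) by
      rw [show (2 * (2 * Real.pi * a) : ℂ) = ((2 * (2 * Real.pi * a) : ℝ) : ℂ) by push_cast; ring, Complex.norm_real, Real.norm_eq_abs,
        abs_of_pos hκ]]
  exact div_le_div_of_nonneg_left hq0.le (by nlinarith) (mul_le_mul_of_nonneg_right hd hκ.le)

/-! ## §2 The block entries -/

/-- **Diagonal entry:** `‖2πia·(−¼ − 2G₀)‖ = a·|π/2 + 2Σ₀(a,β)|` when `2πG₀ = Σ₀` (`a > 0`). [cite: Drazin2002, §8.3 (8.36)–(8.38)] -/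
theorem norm_blockX_diag_eq {a β : ℝ} (ha : 0 < a) {G0 : ℂ} (h0 : (2 * Real.pi : ℂ) * G0 = ((sawSigma0 a β : ℝ) : ℂ)) :
    ‖(((2 * Real.pi * a : ℝ) : ℂ) * Complex.I) * (-(1 / 4 : ℂ) - 2 * G0)‖ = a * |Real.pi / 2 + 2 * sawSigma0 a β| := by
  have hπ : (Real.pi : ℂ) ≠ 0 := by exact_mod_cast Real.pi_ne_zero
  have hG : G0 = ((sawSigma0 a β / (2 * Real.pi) : ℝ) : ℂ) := by
    rw [Complex.ofReal_div]; push_cast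
    rw [eq_div_iff (mul_ne_zero two_ne_zero hπ)]
    linear_combination h0
  rw [hG, show (((2 * Real.pi * a : ℝ) : ℂ) * Complex.I) * (-(1 / 4 : ℂ) - 2 * ((sawSigma0 a β / (2 * Real.pi) : ℝ) : ℂ)) =
      ((-(a * (Real.pi / 2 + 2 * sawSigma0 a β)) : ℝ) : ℂ) * Complex.I by push_cast; field_simp; ring]
  rw [norm_mul, Complex.norm_I, mul_one, Complex.norm_real, Real.norm_eq_abs, abs_neg, abs_mul, abs_of_pos ha]

/-- **Diagonal entry, size:** `‖2πia·(−¼ − 2G₀)‖ ≤ πa/2 − (1−q)/(1+q)` for `a ≥ 1` (`= a·p`, `p = π/2+2Σ₀ ≥ 0`, `2aΣ₀ ≤ −(1−q)/(1+q)`).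
[cite: Drazin2002, §8.3 (8.36)–(8.38)] -/
theorem norm_blockX_diag_le {a β : ℝ} (ha : 1 ≤ a) {G0 : ℂ} (h0 : (2 * Real.pi : ℂ) * G0 = ((sawSigma0 a β : ℝ) : ℂ)) :
    ‖(((2 * Real.pi * a : ℝ) : ℂ) * Complex.I) * (-(1 / 4 : ℂ) - 2 * G0)‖ ≤ Real.pi * a / 2 - (1 - sawQ a) / (1 + sawQ a) := by
  have ha0 : 0 < a := by linarith
  rw [norm_blockX_diag_eq ha0 h0, abs_of_nonneg (kh_p_nonneg ha β)]
  have hσ := sawSigma0_le_of_pos ha0 β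
  have hq0 : 0 < sawQ a := sawQ_pos a
  have e : a * (2 * (-(1 - sawQ a) / (2 * a * (1 + sawQ a)))) = -((1 - sawQ a) / (1 + sawQ a)) := by field_simp
  calc a * (Real.pi / 2 + 2 * sawSigma0 a β) = Real.pi * a / 2 + a * (2 * sawSigma0 a β) := by ring
    _ ≤ Real.pi * a / 2 + a * (2 * (-(1 - sawQ a) / (2 * a * (1 + sawQ a)))) := by
        have := mul_le_mul_of_nonneg_left (mul_le_mul_of_nonneg_left hσ (by norm_num : (0:ℝ) ≤ 2)) ha0.le
        linarith
    _ = Real.pi * a / 2 - (1 - sawQ a) / (1 + sawQ a) := by rw [e]; ring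

/-- **Off-diagonal entry:** `‖2πia·(−2G_h)‖ = 2a‖S_β(a)‖` when `2π conj G_h = S` (`a > 0`). [cite: Drazin2002, §8.3 (8.36)–(8.38)] -/
theorem norm_blockX_off_eq {a β : ℝ} (ha : 0 < a) {Gh : ℂ} (hh : (2 * Real.pi : ℂ) * starRingEnd ℂ Gh = sawS a β) :
    ‖(((2 * Real.pi * a : ℝ) : ℂ) * Complex.I) * (-2 * Gh)‖ = 2 * a * ‖sawS a β‖ := by
  have hn : ‖Gh‖ = ‖sawS a β‖ / (2 * Real.pi) := by
    rw [← hh, norm_mul, Complex.norm_conj, show ‖(2 * Real.pi : ℂ)‖ = 2 * Real.pi by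
      rw [show (2 * Real.pi : ℂ) = ((2 * Real.pi : ℝ) : ℂ) by push_cast; ring, Complex.norm_real, Real.norm_eq_abs, abs_of_pos (by positivity)]]
    field_simp
  rw [norm_mul, norm_mul, norm_mul, Complex.norm_I, mul_one, Complex.norm_real, Real.norm_eq_abs, abs_of_pos (by positivity), norm_neg,
    hn, show ‖(2 : ℂ)‖ = 2 by simp]
  field_simp

/-- **Off-diagonal entry, size:** `‖2πia·(−2G_h)‖ ≤ 40/399` for `a ≥ 1` (`‖S‖ ≤ √q/(a(1−q))`, `√q ≤ 1/20`, `q ≤ 1/400`). [cite: Drazin2002, §8.3 (8.36)–(8.38)] -/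
theorem norm_blockX_off_le {a β : ℝ} (ha : 1 ≤ a) {Gh : ℂ} (hh : (2 * Real.pi : ℂ) * starRingEnd ℂ Gh = sawS a β) :
    ‖(((2 * Real.pi * a : ℝ) : ℂ) * Complex.I) * (-2 * Gh)‖ ≤ 40 / 399 := by
  have ha0 : 0 < a := by linarith
  rw [norm_blockX_off_eq ha0 hh]
  have hS : ‖sawS a β‖ ≤ Real.sqrt (sawQ a) / (a * (1 - sawQ a)) := by
    have h := normSq_sawS_le ha0 β
    have hq1 : sawQ a < 1 := sawQ_lt_one ha0
    rw [show ‖sawS a β‖ = Real.sqrt (Complex.normSq (sawS a β)) from rfl]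
    calc Real.sqrt (Complex.normSq (sawS a β)) ≤ Real.sqrt (sawQ a / (a ^ 2 * (1 - sawQ a) ^ 2)) := Real.sqrt_le_sqrt h
      _ = Real.sqrt (sawQ a) / (a * (1 - sawQ a)) := by
          rw [Real.sqrt_div' _, show a ^ 2 * (1 - sawQ a) ^ 2 = (a * (1 - sawQ a)) ^ 2 by ring,
            Real.sqrt_sq (by nlinarith)]
          positivity
  have hq0 : 0 < sawQ a := sawQ_pos a
  have hq := sawQ_le_of_one_le ha
  have hsq : Real.sqrt (sawQ a) ≤ 1 / 20 := by
    rw [show (1 / 20 : ℝ) = Real.sqrt ((1 / 20) ^ 2) by rw [Real.sqrt_sq (by norm_num)]]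
    exact Real.sqrt_le_sqrt (by nlinarith)
  have h1q : 0 < 1 - sawQ a := by linarith
  calc 2 * a * ‖sawS a β‖ ≤ 2 * a * (Real.sqrt (sawQ a) / (a * (1 - sawQ a))) := by gcongr
    _ = 2 * Real.sqrt (sawQ a) / (1 - sawQ a) := by field_simp
    _ ≤ 40 / 399 := by
        rw [div_le_div_iff₀ h1q (by norm_num)]
        nlinarith [Real.sqrt_nonneg (sawQ a)]

end Summit.AnomalousDissipation.AnomalousDissipation.Theorems.SawtoothPulseCascade.K2PhaseBudget

end
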